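import Literature.AnabelianGeometry.SemiGraphs.AmbientVocabOfReal
import Literature.AnabelianGeometry.SemiGraphs.EmbeddingCriterion

/-!
# Embeddings: the container's `IsGraphEmbedding` at `SemiAnbdVocab.ofReal` is t1's `SemiGraph.IsEmbedding` ([SemiAnbd] §1 p.12)

Mochizuki, *Semi-graphs of anabelioids*, Publ. RIMS **42** (2006), §1 p.12: an *embedding* is a
morphism of semi-graphs inducing an isomorphism onto a sub-semi-graph (kurims
`paper:url-f33ace170ff4`). [cite: MochizukiSemiAnbd2006, §1, p. 12]

PROOF-ONLY `_iff` bridge (L3 merge dictionary, continuing `AmbientVocabDictionary.lean`): the §§4–5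
container (`InterfaceVocab.lean`) unfolds "embedding" as "injective on vertices and on edges, and
reflecting abutment" (`SemiAnbdVocab.IsGraphEmbedding`); t1 defines it literally
(`SemiGraph.IsEmbedding`: `φ = i.hom ≫ H.ι` for an isomorphism `i` onto a sub-semi-graph `H`).  At the
real term the two agree (`SemiAnbdVocab.ofReal_isGraphEmbedding_iff`): one direction is the
embedding criterion `SemiGraph.isEmbedding_of_injective` (`EmbeddingCriterion.lean`), the other reads
injectivity and reflection of abutment off the isomorphism and the inclusion.  No definitions.
-/

namespace Literature.AnabelianGeometry.SemiGraphs

open CategoryTheory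

universe v₁ u₁ u

namespace SemiGraph

variable {X Y : SemiGraph.{u}}

/-- The vertex map of an isomorphism of semi-graphs has the vertex map of the inverse as a left
inverse. [cite: MochizukiSemiAnbd2006, §1, p. 11] -/
theorem Iso.inv_vertexMap_hom_vertexMap (i : X ≅ Y) (v : X.Vertex) :
    i.inv.vertexMap (i.hom.vertexMap v) = v := by
  have := congrArg (fun φ : X ⟶ X => φ.vertexMap v) i.hom_inv_id
  exact this

/-- The edge map of an isomorphism of semi-graphs has the edge map of the inverse as a left inverse.
[cite: MochizukiSemiAnbd2006, §1, p. 11] -/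
theorem Iso.inv_edgeMap_hom_edgeMap (i : X ≅ Y) (e : X.Edge) :
    i.inv.edgeMap (i.hom.edgeMap e) = e := by
  have := congrArg (fun φ : X ⟶ X => φ.edgeMap e) i.hom_inv_id
  exact this

/-- The branch map of an isomorphism of semi-graphs has the branch map of the inverse as a left
inverse. [cite: MochizukiSemiAnbd2006, §1, p. 11] -/
theorem Iso.inv_branchMap_hom_branchMap (i : X ≅ Y) (b : X.Branch) :
    i.inv.branchMap (i.hom.branchMap b) = b := by
  have := congrArg (fun φ : X ⟶ X => φ.branchMap b) i.hom_inv_id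
  exact this

/-- **Embeddings are injective on vertices and on edges and reflect abutment** (the converse of the
embedding criterion `isEmbedding_of_injective`; conditions (a)–(c) of a sub-semi-graph, p.12).
[cite: MochizukiSemiAnbd2006, §1, p. 12] -/
theorem IsEmbedding.injective_and_reflects {φ : X ⟶ Y} (h : IsEmbedding φ) :
    Function.Injective φ.vertexMap ∧ Function.Injective φ.edgeMap ∧
      ∀ (c : X.Branch) (v : X.Vertex),
        Y.abuts (φ.branchMap c) = some (φ.vertexMap v) → X.abuts c = some v := by
  obtain ⟨H, i, rfl⟩ := h
  refine ⟨?_, ?_, fun c v hcv => ?_⟩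
  · intro v₁ v₂ hv
    have hv' : i.hom.vertexMap v₁ = i.hom.vertexMap v₂ := Subtype.ext hv
    rw [← Iso.inv_vertexMap_hom_vertexMap i v₁, hv', Iso.inv_vertexMap_hom_vertexMap]
  · intro e₁ e₂ he
    have he' : i.hom.edgeMap e₁ = i.hom.edgeMap e₂ := Subtype.ext he
    rw [← Iso.inv_edgeMap_hom_edgeMap i e₁, he', Iso.inv_edgeMap_hom_edgeMap]
  · have h₁ : H.toSemiGraph.abuts (i.hom.branchMap c) = some (i.hom.vertexMap v) :=
      (Subgraph.abuts_eq_some_iff H _ _).mpr hcv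
    have h₂ := i.inv.abuts_branchMap _ _ h₁
    rwa [Iso.inv_branchMap_hom_branchMap, Iso.inv_vertexMap_hom_vertexMap] at h₂

/-- **Characterisation of embeddings** (p.12): `φ` is an embedding iff it is injective on vertices
and on edges and reflects abutment. [cite: MochizukiSemiAnbd2006, §1, p. 12] -/
theorem isEmbedding_iff_injective (φ : X ⟶ Y) :
    IsEmbedding φ ↔ Function.Injective φ.vertexMap ∧ Function.Injective φ.edgeMap ∧
      ∀ (c : X.Branch) (v : X.Vertex),
        Y.abuts (φ.branchMap c) = some (φ.vertexMap v) → X.abuts c = some v :=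
  ⟨IsEmbedding.injective_and_reflects, fun h => isEmbedding_of_injective φ h.1 h.2.1 h.2.2⟩

end SemiGraph

namespace SemiAnbdVocab

open SgAQuot SgAQuot.SgA

variable (R : SgA.BridgeResidual.{v₁, u₁, u})

/-- **The container's "embedding" (Def 4.2 / §1 p.12) at the real vocabulary is t1's
`SemiGraph.IsEmbedding`** of the underlying morphism of semi-graphs. [cite: MochizukiSemiAnbd2006, §1, p. 12] -/
theorem ofReal_isGraphEmbedding_iff {G H : SgA.{v₁, u₁, u}} (f : G ⟶ H) :
    (SemiAnbdVocab.ofReal R).IsGraphEmbedding f ↔ SemiGraph.IsEmbedding f.hom.hom.base := by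
  rw [SemiGraph.isEmbedding_iff_injective]
  change (Function.Injective f.hom.hom.base.vertexMap ∧ Function.Injective f.hom.hom.base.edgeMap ∧
      ∀ (e : G.toSgA.graph.Edge) (b : G.toSgA.graph.branchesOf e) (v : G.toSgA.graph.Vertex),
        H.toSgA.graph.abuts (f.hom.hom.base.branchMap b.1) = some (f.hom.hom.base.vertexMap v) →
          G.toSgA.graph.abuts b.1 = some v) ↔ _
  refine and_congr_right fun _ => and_congr_right fun _ => ?_
  constructor
  · intro h c v hcv
    exact h (G.toSgA.graph.edgeOf c) ⟨c, rfl⟩ v hcv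
  · intro h e b v hbv
    exact h b.1 v hbv

end SemiAnbdVocab

end Literature.AnabelianGeometry.SemiGraphs
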